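import Literature.NumberTheory.LFunctions.NicolasOmega
import HarnessLib

/-!
# The Landau–pole endgame: a transform `K/s + M/(s−½) + M/(s+½) + Φ̃(s)·ζ′/ζ(s+½)` of an eventually non-negative `g` admits no off-line pole

Cell `rh-explicit`, TRACK «HANDOFF», seat handoff-prove-1 (gen4).  Generic analytic ENDGAME of the kernel route to LEMMA L
(`WeilBottomDropOfOffLineZero`, `HandoffBottomCriterion.lean`; paper proof idea-1 WEIL-BOTTOM-UNBOUNDED.md §2.3–2.4): NO Weil
objects appear here; theory-2's `HandoffDipoleChebyshev.lean` and the assembly file (Mellin identity of the smoothed Chebyshev sum)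
feed the hypotheses `hpos` / `hagree`.

`false_of_mellin_eq_logDerivZeta`: let `g : ℝ → ℝ` be measurable, `∫_1^∞ |g| x^{-σ₁-1} < ∞` (`σ₁ ≥ ½`), `g ≥ 0` beyond `X₁`, and
on `Re s > σ₁` let `F(s) = ∫_1^∞ g x^{-s-1}` (`Landau.mellinIoi`) equal `K/s + M/(s−½) + M/(s+½) + Φ̃(s)ζ′(s+½)/ζ(s+½)` with `Φ̃`
ENTIRE and `Φ̃(½) = M` (the pole at `s + ½ = 1` cancels).  Then no zero `ρ₀` of `ζ` with `Re ρ₀ > ½`, right-most on its line, has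
`Φ̃(ρ₀ − ½) ≠ 0`.  Variant `false_of_mellin_eq_LSeries_vonMangoldt` with `−Φ̃(s)·L(Λ, s+½)` on the right.
PROOF (MV2007, proof of Thm. 15.2; the tree's `NicolasOmega.false_of_zetaOne_zero` pattern): with `Z₁(w) = wζ(1+w)` (`zetaOne`),
`ζ′/ζ(s+½) = Z₁′/Z₁(s−½) − 1/(s−½)`, so the right side is `Φ(s) = K/s + M/(s+½) − dslope Φ̃ ½ s + Φ̃(s)Z₁′/Z₁(s−½)`, holomorphic on
`O = {Re s > 0} ∩ {Z₁(s−½) ≠ 0}` ⊇ `{Re s > σ₁}` ∪ (convex neighbourhood of the real segment `(a′, σ₁+1]`, `a′ > 0`).  Landau's lemma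
(`Landau.integrableOn_of_differentiableOn_union_convex`, `a′ = (Re ρ₀ − ½)/2`) makes `F` holomorphic AT `s₀ = ρ₀ − ½`; the identity
theorem on `{Re s > σ₁} ∪ (thickened ray right of s₀) ∪ (half-disc at s₀)` gives `F = Φ` there; along `s₀ + δ`, `δ ↓ 0`,
`δF(s₀+δ) → 0` but `δΦ(s₀+δ) → mΦ̃(s₀) ≠ 0` (`Z₁(w) = (w−w₀)^m h(w)` at `w₀ = ρ₀ − 1`).  Also: `exists_rightmost_zero_of_offline_zero`.
HONEST FRAMING: nothing here is a step towards RH — the theorem runs from an OFF-LINE zero to a contradiction with eventual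
non-negativity (in the application: from `¬RH` to negativity of the Weil window bottom).  Label THEOREM (kernel).
References: Montgomery–Vaughan 2007 §15.1, Lemma 15.1 and proof of Thm. 15.2 [MontgomeryVaughan2007]; this track idea-1 / theory-1 §J.9.
-/

set_option linter.dupNamespace false  -- the mandated namespace repeats `RiemannHypothesis`

noncomputable section

open Complex Filter Topology Set MeasureTheory Metric
open Literature.NumberTheory.LFunctions Literature.NumberTheory.LFunctions.Landau
  Literature.NumberTheory.LFunctions.Nicolas

namespace Summit.RiemannHypothesis.RiemannHypothesis.Theorems.HandoffDecomposition

/-! ### `Z₁ = zetaOne` bookkeeping: `Z₁(w) = w ζ(1+w)` -/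

/-- `Z₁(s − ½) ≠ 0` whenever `Re s ≥ ½` (`Z₁(0) = 1`; otherwise `ζ(s + ½) ≠ 0` for `Re(s+½) ≥ 1`). [folklore] -/
theorem zetaOne_sub_half_ne_zero_of_half_le_re {s : ℂ} (hs : 1 / 2 ≤ s.re) : zetaOne (s - 1 / 2) ≠ 0 := by
  intro h
  obtain ⟨-, hζ⟩ := zetaOne_eq_zero_iff.1 h
  refine riemannZeta_ne_zero_of_one_le_re (s := 1 + (s - 1 / 2)) ?_ hζ
  rw [show (1 + (s - 1 / 2)).re = s.re + 1 / 2 by simp; ring]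
  linarith

/-- `Z₁(σ − ½) ≠ 0` for real `σ > −½` (`Z₁` is real and positive on `(−1, ∞)`). [folklore] -/
theorem zetaOne_ofReal_sub_half_ne_zero {σ : ℝ} (hσ : -1 / 2 < σ) : zetaOne ((σ : ℂ) - 1 / 2) ≠ 0 := by
  have : ((σ : ℂ) - 1 / 2) = ((σ - 1 / 2 : ℝ) : ℂ) := by push_cast; ring
  rw [this]
  exact zetaOne_ofReal_ne_zero (by linarith)

/-- The domain `O = {Re s > 0} ∩ {Z₁(s − ½) ≠ 0}` of the continuation is open. [folklore] -/
theorem isOpen_landauPoleDom : IsOpen {s : ℂ | 0 < s.re ∧ zetaOne (s - 1 / 2) ≠ 0} :=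
  (isOpen_re_gt' 0).inter
    (isOpen_ne_fun (continuous_zetaOne.comp (continuous_id.sub continuous_const)) continuous_const)

/-- **The continuation `Φ(s) = K/s + M/(s+½) − dslope Φ̃ ½ s + Φ̃(s)·Z₁′/Z₁(s−½)` is holomorphic on `O`** (`Φ̃` entire: the
difference quotient `dslope Φ̃ ½` is entire, Mathlib `Complex.differentiableOn_dslope`). [folklore] -/
theorem differentiableOn_landauPoleCont (K M : ℂ) {Φt : ℂ → ℂ} (hΦt : Differentiable ℂ Φt) :
    DifferentiableOn ℂ
      (fun s : ℂ ↦ K / s + M / (s + 1 / 2) - dslope Φt (1 / 2) s +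
        Φt s * (deriv zetaOne (s - 1 / 2) / zetaOne (s - 1 / 2)))
      {s : ℂ | 0 < s.re ∧ zetaOne (s - 1 / 2) ≠ 0} := by
  intro s hs
  obtain ⟨hre, hZ⟩ := hs
  have hs0 : s ≠ 0 := by rintro rfl; simp at hre
  have hs1 : s + 1 / 2 ≠ 0 := by
    intro h; have := congrArg Complex.re h; simp at this; linarith
  have hdsl : DifferentiableAt ℂ (dslope Φt (1 / 2)) s := by
    have h : DifferentiableOn ℂ (dslope Φt (1 / 2)) univ :=
      (differentiableOn_dslope (univ_mem : (univ : Set ℂ) ∈ 𝓝 (1 / 2 : ℂ))).2 hΦt.differentiableOn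
    exact h.differentiableAt univ_mem
  have hsub : DifferentiableAt ℂ (fun z : ℂ ↦ z - 1 / 2) s := differentiableAt_id.sub (differentiableAt_const _)
  have hZd : DifferentiableAt ℂ (fun z : ℂ ↦ deriv zetaOne (z - 1 / 2)) s := by
    have := ((analyticAt_zetaOne (s - 1 / 2)).deriv.differentiableAt).comp s hsub
    simpa [Function.comp_def] using this
  have hZ0 : DifferentiableAt ℂ (fun z : ℂ ↦ zetaOne (z - 1 / 2)) s := by
    have := (differentiable_zetaOne (s - 1 / 2)).comp s hsub
    simpa [Function.comp_def] using this
  refine DifferentiableAt.differentiableWithinAt ?_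
  exact ((((differentiableAt_const K).div differentiableAt_id hs0).add
    ((differentiableAt_const M).div (differentiableAt_id.add (differentiableAt_const _)) hs1)).sub hdsl).add
    ((hΦt s).mul (hZd.div hZ0 hZ))

/-- On `Re s > σ₁ ≥ ½` the continuation IS the hypothesised right-hand side:
`K/s + M/(s−½) + M/(s+½) + Φ̃(s)·ζ′/ζ(s+½) = Φ(s)` (uses `Φ̃(½) = M` and `Z₁′/Z₁(s−½) = 1/(s−½) + ζ′/ζ(s+½)`). [folklore] -/
theorem landauPoleCont_eq_of_half_lt_re (K M : ℂ) {Φt : ℂ → ℂ} (hM : Φt (1 / 2) = M) {s : ℂ} (hs : 1 / 2 < s.re) :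
    K / s + M / (s + 1 / 2) - dslope Φt (1 / 2) s + Φt s * (deriv zetaOne (s - 1 / 2) / zetaOne (s - 1 / 2)) =
      K / s + M / (s - 1 / 2) + M / (s + 1 / 2) +
        Φt s * (deriv riemannZeta (s + 1 / 2) / riemannZeta (s + 1 / 2)) := by
  have hw : s - 1 / 2 ≠ 0 := by
    intro h; have := congrArg Complex.re h; simp at this; linarith
  have hne : s ≠ 1 / 2 := fun h ↦ hw (by rw [h]; ring)
  have hζ : riemannZeta (1 + (s - 1 / 2)) ≠ 0 := by
    refine riemannZeta_ne_zero_of_one_le_re ?_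
    have : (1 + (s - 1 / 2)).re = s.re + 1 / 2 := by simp; ring
    rw [this]; linarith
  rw [deriv_zetaOne_div hw hζ, dslope_of_ne _ hne, slope_def_field, hM,
    show (1 : ℂ) + (s - 1 / 2) = s + 1 / 2 by ring]
  field_simp
  ring

/-! ### A right-most zero -/

/-- From ONE zero `ρ` of `ζ` with `½ < Re ρ < 1`: a zero `ρ₀` with `½ < Re ρ₀ < 1` which is RIGHT-MOST on its horizontal line
(`ζ ≠ 0` on the open ray to its right).  (`= Nicolas.exists_zero_right_of_not_RH`, translated from `Z₁(s) = sζ(1+s)` back to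
`ζ`; the input shape of `false_of_mellin_eq_logDerivZeta`.) [folklore] -/
theorem exists_rightmost_zero_of_offline_zero {ρ : ℂ} (hρ : riemannZeta ρ = 0) (h1 : 1 / 2 < ρ.re) (h2 : ρ.re < 1) :
    ∃ ρ₀ : ℂ, riemannZeta ρ₀ = 0 ∧ 1 / 2 < ρ₀.re ∧ ρ₀.re < 1 ∧
      ∀ t : ℝ, 0 < t → riemannZeta (ρ₀ + t) ≠ 0 := by
  have hRH : ¬ _root_.RiemannHypothesis := by
    intro hRH
    have htriv : ¬∃ n : ℕ, ρ = -2 * (n + 1) := by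
      rintro ⟨n, hn⟩
      have := congrArg Complex.re hn
      simp at this
      linarith [(n.cast_nonneg : (0 : ℝ) ≤ n)]
    have hne : ρ ≠ 1 := by rintro rfl; simp at h2
    have := hRH ρ hρ htriv hne
    linarith
  obtain ⟨s₀, hZ, hre1, hre2, hray⟩ := exists_zero_right_of_not_RH hRH
  obtain ⟨hs₀, hζ⟩ := zetaOne_eq_zero_iff.1 hZ
  refine ⟨1 + s₀, hζ, by simp; linarith, by simp; linarith, fun t ht h ↦ hray t ht ?_⟩
  refine zetaOne_eq_zero_iff.2 ⟨fun h0 ↦ ?_, by rwa [show (1 : ℂ) + (s₀ + t) = 1 + s₀ + t by ring]⟩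
  have := congrArg Complex.im h0
  simp at this
  exact im_ne_zero_of_zetaOne_eq_zero hZ (by linarith) this

/-! ### The endgame -/

/-- **THE LANDAU–POLE ENDGAME.**  Let `g ≥ 0` beyond `X₁` be measurable with `∫_1^∞ |g| x^{-σ₁-1} < ∞` (`σ₁ ≥ ½`), and suppose
its transform is `K/s + M/(s−½) + M/(s+½) + Φ̃(s)·ζ′(s+½)/ζ(s+½)` on `Re s > σ₁`, with `Φ̃` entire and `Φ̃(½) = M`.  Then no zero
`ρ₀` of `ζ` with `Re ρ₀ > ½`, right-most on its line, has `Φ̃(ρ₀ − ½) ≠ 0`.  (Landau's lemma pushes the abscissa of absolute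
convergence below `Re ρ₀ − ½`, so the transform is holomorphic at `s₀ = ρ₀ − ½`, where the right-hand side has a genuine pole of
residue `m·Φ̃(s₀)`.) [cite: MontgomeryVaughan2007, §15.1 Lemma 15.1 and proof of Thm. 15.2 (method)] -/
theorem false_of_mellin_eq_logDerivZeta {g : ℝ → ℝ} (hg : Measurable g) {σ₁ : ℝ} (hσ₁ : 1 / 2 ≤ σ₁)
    (hint : IntegrableOn (fun x ↦ g x * x ^ (-(σ₁ + 1))) (Ioi 1)) {X₁ : ℝ} (hX₁ : 1 ≤ X₁)
    (hpos : ∀ x, X₁ < x → 0 ≤ g x) {K M : ℂ} {Φt : ℂ → ℂ} (hΦt : Differentiable ℂ Φt)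
    (hM : Φt (1 / 2) = M)
    (hagree : ∀ s : ℂ, σ₁ < s.re → mellinIoi g s =
      K / s + M / (s - 1 / 2) + M / (s + 1 / 2) +
        Φt s * (deriv riemannZeta (s + 1 / 2) / riemannZeta (s + 1 / 2)))
    {ρ₀ : ℂ} (h0 : riemannZeta ρ₀ = 0) (hρ : 1 / 2 < ρ₀.re)
    (hray : ∀ t : ℝ, 0 < t → riemannZeta (ρ₀ + t) ≠ 0) (hΦρ : Φt (ρ₀ - 1 / 2) ≠ 0) : False := by
  -- the continuation `Φ` and its domain `O`
  set Φ : ℂ → ℂ := fun s ↦ K / s + M / (s + 1 / 2) - dslope Φt (1 / 2) s +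
    Φt s * (deriv zetaOne (s - 1 / 2) / zetaOne (s - 1 / 2)) with hΦdef
  set O : Set ℂ := {s : ℂ | 0 < s.re ∧ zetaOne (s - 1 / 2) ≠ 0} with hOdef
  have hOo : IsOpen O := isOpen_landauPoleDom
  have hΦO : DifferentiableOn ℂ Φ O := differentiableOn_landauPoleCont K M hΦt
  set P : Set ℂ := {s : ℂ | σ₁ < s.re} with hPdef
  have hPo : IsOpen P := isOpen_re_gt' σ₁
  have hPO : P ⊆ O := fun s hs ↦
    ⟨by simp only [hPdef, mem_setOf_eq] at hs; linarith,
      zetaOne_sub_half_ne_zero_of_half_le_re (by simp only [hPdef, mem_setOf_eq] at hs; linarith)⟩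
  have hagreeP : EqOn Φ (mellinIoi g) P := by
    intro s hs
    have hs' : σ₁ < s.re := hs
    rw [hagree s hs', hΦdef]
    exact landauPoleCont_eq_of_half_lt_re K M hM (by linarith)
  -- the zero: `s₀ = ρ₀ − ½`, `w₀ = ρ₀ − 1`, `Z₁(w₀) = 0`
  have hρ1 : ρ₀.re < 1 := lt_of_not_ge fun h ↦ riemannZeta_ne_zero_of_one_le_re h h0
  set s₀ : ℂ := ρ₀ - 1 / 2 with hs₀def
  set w₀ : ℂ := ρ₀ - 1 with hw₀def
  have hs₀re : s₀.re = ρ₀.re - 1 / 2 := by simp [hs₀def]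
  have hs₀pos : 0 < s₀.re := by rw [hs₀re]; linarith
  have hs₀w₀ : s₀ - 1 / 2 = w₀ := by rw [hs₀def, hw₀def]; ring
  have hZ : zetaOne w₀ = 0 := by
    refine zetaOne_eq_zero_iff.2 ⟨fun h ↦ ?_, by rwa [show (1 : ℂ) + w₀ = ρ₀ by rw [hw₀def]; ring]⟩
    have := congrArg Complex.re h
    simp [hw₀def] at this
    linarith
  obtain ⟨m, h, r₁, hm, hr₁, hh, hh0, hhne, hhd, hfac, hlog⟩ := exists_logDeriv_zetaOne_eq hZ
  -- Landau's lemma with `a′ = Re s₀ / 2`: `F` is holomorphic on `Re s > a′ ∋ s₀`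
  set a' : ℝ := s₀.re / 2 with ha'def
  have ha'pos : 0 < a' := by rw [ha'def]; linarith
  have ha's₀ : a' < s₀.re := by rw [ha'def]; linarith
  have ha'σ₁ : a' < σ₁ := by rw [ha'def]; linarith
  obtain ⟨W₀, hW₀o, hW₀c, hW₀r, hW₀O⟩ : ∃ W₀ : Set ℂ, IsOpen W₀ ∧ Convex ℝ W₀ ∧
      (∀ σ : ℝ, a' < σ → σ ≤ σ₁ + 1 → (σ : ℂ) ∈ W₀) ∧ W₀ ⊆ O := by
    set K₀ : Set ℂ := Icc a' (σ₁ + 1) ×ℂ {0} with hK₀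
    have hK₀c : IsCompact K₀ := isCompact_Icc.reProdIm isCompact_singleton
    have hK₀conv : Convex ℝ K₀ :=
      ((convex_Icc _ _).linear_preimage Complex.reLm).inter
        ((convex_singleton (0 : ℝ)).linear_preimage Complex.imLm)
    have hK₀O : K₀ ⊆ O := by
      intro z hz
      rw [hK₀, mem_reProdIm] at hz
      have hzim : z.im = 0 := hz.2
      have hz' : z = ((z.re : ℝ) : ℂ) := Complex.ext (by simp) (by simp [hzim])
      refine ⟨by linarith [hz.1.1], ?_⟩
      rw [hz']
      exact zetaOne_ofReal_sub_half_ne_zero (by linarith [hz.1.1])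
    obtain ⟨δ, hδ, hsub⟩ := hK₀c.exists_thickening_subset_open hOo hK₀O
    refine ⟨thickening δ K₀, isOpen_thickening, hK₀conv.thickening δ, fun σ h1 h2 ↦ ?_, hsub⟩
    refine self_subset_thickening hδ K₀ ?_
    rw [hK₀, mem_reProdIm]
    exact ⟨⟨by simpa using h1.le, by simpa using h2⟩, by simp⟩
  have hL : ∀ σ : ℝ, a' < σ → IntegrableOn (fun x ↦ g x * x ^ (-(σ + 1))) (Ioi 1) := fun σ hσ ↦
    integrableOn_of_differentiableOn_union_convex hg hint hX₁ hpos ha'σ₁ hW₀o hW₀c hW₀r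
      (Φ := Φ) (hΦO.mono (union_subset hPO hW₀O)) hagreeP hσ
  have hF : DifferentiableOn ℂ (mellinIoi g) {s : ℂ | a' < s.re} :=
    differentiableOn_mellinIoi_of_forall hg hL
  have hFs₀ : ContinuousAt (mellinIoi g) s₀ :=
    (hF.differentiableAt ((isOpen_re_gt' a').mem_nhds ha's₀)).continuousAt
  -- the region `U = P ∪ A₁ ∪ A₂` (half-plane, thickened ray to the right of `s₀`, half-disc at `s₀`)
  set r₀ : ℝ := min r₁ (s₀.re / 2) with hr₀def
  have hr₀ : 0 < r₀ := lt_min hr₁ (by linarith)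
  have hr₀₁ : r₀ ≤ r₁ := min_le_left _ _
  have hr₀s : r₀ ≤ s₀.re / 2 := min_le_right _ _
  set O' : Set ℂ := O ∩ {s : ℂ | a' < s.re} with hO'def
  have hO'o : IsOpen O' := hOo.inter (isOpen_re_gt' a')
  set Hsp : Set ℂ := {z : ℂ | s₀.re < z.re} with hHsp
  set A₂ : Set ℂ := ball s₀ r₀ ∩ Hsp with hA₂
  set K₁ : Set ℂ := Icc (s₀.re + r₀ / 2) (σ₁ + 1) ×ℂ {s₀.im} with hK₁
  -- points `s₀ + t`, `t > 0`, are zero-free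
  have hrayZ : ∀ t : ℝ, 0 < t → zetaOne (s₀ + t - 1 / 2) ≠ 0 := by
    intro t ht hz
    obtain ⟨-, hζ⟩ := zetaOne_eq_zero_iff.1 hz
    refine hray t ht ?_
    rwa [show (1 : ℂ) + (s₀ + t - 1 / 2) = ρ₀ + t by rw [hs₀def]; ring] at hζ
  have hK₁O : K₁ ⊆ O' := by
    intro z hz
    rw [hK₁, mem_reProdIm] at hz
    obtain ⟨⟨hz1, hz2⟩, hz3⟩ := hz
    have hz3' : z.im = s₀.im := hz3
    have hzt : z = s₀ + ((z.re - s₀.re : ℝ) : ℂ) := Complex.ext (by simp) (by simp [hz3'])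
    refine ⟨⟨by linarith, ?_⟩, show a' < z.re by linarith⟩
    have := hrayZ (z.re - s₀.re) (by linarith)
    rwa [← hzt] at this
  have hK₁c : IsCompact K₁ := isCompact_Icc.reProdIm isCompact_singleton
  have hK₁conv : Convex ℝ K₁ :=
    ((convex_Icc _ _).linear_preimage Complex.reLm).inter
      ((convex_singleton (s₀.im)).linear_preimage Complex.imLm)
  obtain ⟨δ₁, hδ₁, hA₁O⟩ := hK₁c.exists_thickening_subset_open hO'o hK₁O
  set A₁ : Set ℂ := thickening δ₁ K₁ with hA₁
  set U : Set ℂ := (P ∪ A₁) ∪ A₂ with hU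
  have hA₂O : A₂ ⊆ O' := by
    intro z hz
    have hzb : z ∈ ball s₀ r₀ := hz.1
    have hzre : s₀.re < z.re := hz.2
    have hzs : z ≠ s₀ := by rintro rfl; exact lt_irrefl _ hzre
    rw [mem_ball, Complex.dist_eq] at hzb
    refine ⟨⟨by linarith, ?_⟩, show a' < z.re by linarith⟩
    have hw1 : z - 1 / 2 ∈ ball w₀ r₁ := by
      rw [mem_ball, Complex.dist_eq, ← hs₀w₀, show z - 1 / 2 - (s₀ - 1 / 2) = z - s₀ by ring]
      linarith
    have hne : z - 1 / 2 - w₀ ≠ 0 := by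
      rw [← hs₀w₀, show z - 1 / 2 - (s₀ - 1 / 2) = z - s₀ by ring]
      exact sub_ne_zero.2 hzs
    rw [hfac _ hw1]
    exact mul_ne_zero (pow_ne_zero _ hne) (hhne _ hw1)
  have hPO' : P ⊆ O' := fun s hs ↦ ⟨hPO hs, show a' < s.re by have : σ₁ < s.re := hs; linarith⟩
  have hUO' : U ⊆ O' := union_subset (union_subset hPO' hA₁O) hA₂O
  have hHo : IsOpen Hsp := isOpen_re_gt' _
  have hUo : IsOpen U := (hPo.union isOpen_thickening).union (isOpen_ball.inter hHo)
  -- two witnesses of connectedness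
  have p₁K : s₀ + ((σ₁ + 1 - s₀.re : ℝ) : ℂ) ∈ K₁ := by
    rw [hK₁, mem_reProdIm]
    exact ⟨⟨by simp only [add_re, ofReal_re]; linarith, by simp only [add_re, ofReal_re]; linarith⟩, by simp⟩
  have p₁P : s₀ + ((σ₁ + 1 - s₀.re : ℝ) : ℂ) ∈ P := by
    show σ₁ < (s₀ + ((σ₁ + 1 - s₀.re : ℝ) : ℂ)).re
    simp only [add_re, ofReal_re]; linarith
  have p₂K : s₀ + ((r₀ / 2 : ℝ) : ℂ) ∈ K₁ := by
    rw [hK₁, mem_reProdIm]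
    exact ⟨⟨by simp only [add_re, ofReal_re]; linarith, by simp only [add_re, ofReal_re]; linarith⟩, by simp⟩
  have hUconn : IsPreconnected U := by
    refine IsPreconnected.union' ?_ (IsPreconnected.union' ?_
      (convex_halfSpace_re_gt σ₁).isPreconnected (hK₁conv.thickening δ₁).isPreconnected)
      ((convex_ball _ _).inter (convex_halfSpace_re_gt _)).isPreconnected
    · refine ⟨s₀ + ((r₀ / 2 : ℝ) : ℂ), Or.inr (self_subset_thickening hδ₁ _ p₂K), ?_, ?_⟩
      · rw [mem_ball, Complex.dist_eq, add_sub_cancel_left, norm_real, Real.norm_eq_abs,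
          abs_of_pos (by linarith)]
        linarith
      · show s₀.re < (s₀ + ((r₀ / 2 : ℝ) : ℂ)).re
        simp only [add_re, ofReal_re]; linarith
    · exact ⟨s₀ + ((σ₁ + 1 - s₀.re : ℝ) : ℂ), p₁P, self_subset_thickening hδ₁ _ p₁K⟩
  -- identity theorem: `F = Φ` on `U`
  have hFU : AnalyticOnNhd ℂ (mellinIoi g) U := (hF.mono fun z hz ↦ (hUO' hz).2).analyticOnNhd hUo
  have hΦU : AnalyticOnNhd ℂ Φ U := (hΦO.mono fun z hz ↦ (hUO' hz).1).analyticOnNhd hUo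
  have hp₁U : s₀ + ((σ₁ + 1 - s₀.re : ℝ) : ℂ) ∈ U := Or.inl (Or.inl p₁P)
  have hev : mellinIoi g =ᶠ[𝓝 (s₀ + ((σ₁ + 1 - s₀.re : ℝ) : ℂ))] Φ := by
    filter_upwards [hPo.mem_nhds p₁P] with z hz
    exact (hagreeP hz).symm
  have hEq : EqOn (mellinIoi g) Φ U := hFU.eqOn_of_preconnected_of_eventuallyEq hΦU hUconn hp₁U hev
  -- the path `z_δ = s₀ + δ`
  set zδ : ℝ → ℂ := fun δ ↦ s₀ + (δ : ℂ) with hzδ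
  have hmemA₂ : ∀ δ : ℝ, 0 < δ → δ < r₀ → zδ δ ∈ A₂ := by
    intro δ hδ hδ'
    refine ⟨?_, ?_⟩
    · rw [mem_ball, Complex.dist_eq, hzδ]
      simp only [add_sub_cancel_left, norm_real, Real.norm_eq_abs, abs_of_pos hδ]
      exact hδ'
    · show s₀.re < (s₀ + (δ : ℂ)).re
      simp only [add_re, ofReal_re]; linarith
  have hzδ_tendsto : Tendsto zδ (𝓝[>] 0) (𝓝 s₀) := by
    have hc : Continuous zδ := continuous_const.add continuous_ofReal
    have := hc.tendsto 0
    simp only [hzδ, ofReal_zero, add_zero] at this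
    exact this.mono_left nhdsWithin_le_nhds
  have hδ_tendsto : Tendsto (fun δ : ℝ ↦ (δ : ℂ)) (𝓝[>] 0) (𝓝 0) := by
    simpa only [ofReal_zero] using (continuous_ofReal.tendsto (0 : ℝ)).mono_left nhdsWithin_le_nhds
  -- (1) `δ · F(z_δ) → 0`
  have T1 : Tendsto (fun δ : ℝ ↦ (δ : ℂ) * mellinIoi g (zδ δ)) (𝓝[>] 0) (𝓝 0) := by
    have := hδ_tendsto.mul (hFs₀.tendsto.comp hzδ_tendsto)
    simpa using this
  -- (2) `δ · Φ(z_δ) → m · Φ̃(s₀)`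
  set E : ℂ → ℂ := fun s ↦ K / s + M / (s + 1 / 2) - dslope Φt (1 / 2) s with hEdef
  set q : ℂ → ℂ := fun w ↦ deriv h w / h w with hqdef
  have hs₀0 : s₀ ≠ 0 := by
    intro h0'; have := congrArg Complex.re h0'; simp at this; linarith
  have hs₀1 : s₀ + 1 / 2 ≠ 0 := by
    intro h0'; have := congrArg Complex.re h0'; simp at this; linarith
  have hEc : ContinuousAt E s₀ := by
    have hdsl : DifferentiableAt ℂ (dslope Φt (1 / 2)) s₀ := by
      have h : DifferentiableOn ℂ (dslope Φt (1 / 2)) univ :=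
        (differentiableOn_dslope (univ_mem : (univ : Set ℂ) ∈ 𝓝 (1 / 2 : ℂ))).2 hΦt.differentiableOn
      exact h.differentiableAt univ_mem
    exact ((((differentiableAt_const K).div differentiableAt_id hs₀0).add
      ((differentiableAt_const M).div (differentiableAt_id.add (differentiableAt_const _)) hs₀1)).sub
      hdsl).continuousAt
  have hqc : ContinuousAt q w₀ := ((hh.deriv.differentiableAt).div hh.differentiableAt hh0).continuousAt
  have hzδw : Tendsto (fun δ : ℝ ↦ zδ δ - 1 / 2) (𝓝[>] 0) (𝓝 w₀) := by
    rw [← hs₀w₀]; exact hzδ_tendsto.sub_const _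
  have T2 : Tendsto (fun δ : ℝ ↦ (δ : ℂ) * Φ (zδ δ)) (𝓝[>] 0) (𝓝 ((m : ℂ) * Φt s₀)) := by
    have hΦtc : Tendsto (fun δ : ℝ ↦ Φt (zδ δ)) (𝓝[>] 0) (𝓝 (Φt s₀)) :=
      (hΦt s₀).continuousAt.tendsto.comp hzδ_tendsto
    have tE : Tendsto (fun δ : ℝ ↦ (δ : ℂ) * E (zδ δ)) (𝓝[>] 0) (𝓝 0) := by
      have := hδ_tendsto.mul (hEc.tendsto.comp hzδ_tendsto)
      simpa using this
    have tM : Tendsto (fun δ : ℝ ↦ (m : ℂ) * Φt (zδ δ)) (𝓝[>] 0) (𝓝 ((m : ℂ) * Φt s₀)) :=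
      hΦtc.const_mul _
    have tQ : Tendsto (fun δ : ℝ ↦ (δ : ℂ) * (Φt (zδ δ) * q (zδ δ - 1 / 2))) (𝓝[>] 0) (𝓝 0) := by
      have := hδ_tendsto.mul (hΦtc.mul (hqc.tendsto.comp hzδw))
      simpa using this
    have hsum := tE.add (tM.add tQ)
    simp only [zero_add, add_zero] at hsum
    refine hsum.congr' ?_
    filter_upwards [Ioo_mem_nhdsGT hr₀] with δ hδ
    have hδ0 : (δ : ℂ) ≠ 0 := by exact_mod_cast hδ.1.ne'
    have hw1 : zδ δ - 1 / 2 ∈ ball w₀ r₁ := by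
      rw [mem_ball, Complex.dist_eq, ← hs₀w₀, hzδ]
      simp only [show s₀ + (δ : ℂ) - 1 / 2 - (s₀ - 1 / 2) = (δ : ℂ) by ring, norm_real, Real.norm_eq_abs,
        abs_of_pos hδ.1]
      linarith [hδ.2]
    have hne : zδ δ - 1 / 2 ≠ w₀ := by
      rw [← hs₀w₀, hzδ]
      exact fun h' ↦ hδ0 (by linear_combination h')
    have hsub : zδ δ - 1 / 2 - w₀ = (δ : ℂ) := by rw [← hs₀w₀, hzδ]; ring
    simp only [hΦdef, hEdef, hqdef]
    rw [hlog _ hw1 hne, hsub]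
    field_simp
  -- (3) but `δ · F(z_δ) = δ · Φ(z_δ)` for small `δ > 0`
  have hEv : (fun δ : ℝ ↦ (δ : ℂ) * mellinIoi g (zδ δ)) =ᶠ[𝓝[>] 0] fun δ : ℝ ↦ (δ : ℂ) * Φ (zδ δ) := by
    filter_upwards [Ioo_mem_nhdsGT hr₀] with δ hδ
    rw [hEq (Or.inr (hmemA₂ δ hδ.1 hδ.2))]
  have hlim : (m : ℂ) * Φt s₀ = 0 := tendsto_nhds_unique (T2.congr' hEv.symm) T1
  have hm0 : (m : ℂ) ≠ 0 := by exact_mod_cast hm.ne'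
  exact mul_ne_zero hm0 (by rwa [hs₀def]) hlim

/-- **The same endgame with the prime side as the von Mangoldt `L`-series** (Mathlib: `L(Λ, w) = −ζ′(w)/ζ(w)`, `Re w > 1`):
transform `K/s + M/(s−½) + M/(s+½) − Φ̃(s)·L(Λ, s+½)` on `Re s > σ₁ ≥ ½` — the shape of a smoothed `√x`-normalised Chebyshev sum
`Σ Λ(n) n^{-1/2} φ(log n − log x)`, `Φ̃(s) = ∫ φ(v) e^{sv} dv` — admits no right-most off-line zero `ρ₀` with `Φ̃(ρ₀ − ½) ≠ 0`.
[cite: MontgomeryVaughan2007, §15.1 Lemma 15.1 and proof of Thm. 15.2 (method)] -/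
theorem false_of_mellin_eq_LSeries_vonMangoldt {g : ℝ → ℝ} (hg : Measurable g) {σ₁ : ℝ} (hσ₁ : 1 / 2 ≤ σ₁)
    (hint : IntegrableOn (fun x ↦ g x * x ^ (-(σ₁ + 1))) (Ioi 1)) {X₁ : ℝ} (hX₁ : 1 ≤ X₁)
    (hpos : ∀ x, X₁ < x → 0 ≤ g x) {K M : ℂ} {Φt : ℂ → ℂ} (hΦt : Differentiable ℂ Φt)
    (hM : Φt (1 / 2) = M)
    (hagree : ∀ s : ℂ, σ₁ < s.re → mellinIoi g s =
      K / s + M / (s - 1 / 2) + M / (s + 1 / 2) -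
        Φt s * LSeries (fun n ↦ ((ArithmeticFunction.vonMangoldt n : ℝ) : ℂ)) (s + 1 / 2))
    {ρ₀ : ℂ} (h0 : riemannZeta ρ₀ = 0) (hρ : 1 / 2 < ρ₀.re)
    (hray : ∀ t : ℝ, 0 < t → riemannZeta (ρ₀ + t) ≠ 0) (hΦρ : Φt (ρ₀ - 1 / 2) ≠ 0) : False := by
  refine false_of_mellin_eq_logDerivZeta hg hσ₁ hint hX₁ hpos (K := K) hΦt hM (fun s hs ↦ ?_) h0 hρ hray hΦρ
  have h1 : 1 < (s + 1 / 2).re := by simp; linarith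
  rw [hagree s hs, ArithmeticFunction.LSeries_vonMangoldt_eq_deriv_riemannZeta_div h1, neg_div]
  ring

end Summit.RiemannHypothesis.RiemannHypothesis.Theorems.HandoffDecomposition

end
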